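/-
Copyright (c) 2026 the pub-hodgecm-mathlib formalisation cell (harness21).  Prover seat hodgecm-mathlib-LH4-p12 (g7), req620 Track A «(D-RAM) FOUR-FRAME», line LH4
(STAGE-1b tier-0 regular row, (L-sq) producer (S2a-κ) «labelled κ-Stage A₀» = the FIRST binder `hAκ0sq` of ★ p859556
`F0P3cDyRamSqKappaSignModelSumOfLabelledStageB.sqKappaSignModelSum2_of_labelledKappaStageB`, discharged; dealer LH4-plan (g13) STAGE-1b directive draft v2 §3).  2026-09-04.
-/
import Summits.HodgeConjecture.HodgeConjecture.Theorems.F0P3cDyRamDiagonalKappaOrbitCountLabelled  -- ★ (LH4-p09 (g8), 09:16Z): labelled (Oκ2a) + labelled (Oκ2c) at ANY type, unconditional (over ★ (Oκ2c)-MULT); brings ★ p856579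
import Summits.HodgeConjecture.HodgeConjecture.Theorems.F0P3cDyRamDiagonalOrbitCountLabelled   -- ★ (LH4-p09 (g8)): labelled pairs re-indexing, `finsum_mem_sep_eq_finsum_mem_ite`, label invariance
import Summits.HodgeConjecture.HodgeConjecture.Theorems.F0P3cDyRamSqKappaSignModelSumOfLabelledStageB  -- ★ p859556 (this seat): the (S2c) composition engine (for the §2 tie probe only)
import HarnessLib

/-!
# Crux `H413`, line LH4 «(D-RAM) FOUR-FRAME» — (S2a-κ) THE LABELLED κ-STAGE A AT TYPE 0 (the κ-twist of ★ LH4-p09's labelled Stage A ∕ the label-cut of ★ (Oκ2c)₀)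

★ p856579 `F0P3cDyRamDiagonalKappaOrbitCount.cast_sum_signChar_mul_ncard_eq_eight_mul_finsum_kappaCount_zero` is κ-Stage A of (KMS) in the unimodular
diagonal model: `↑(Σ_e χ⁰_i(e)·#{M : M type-0 for diag(c^{e}), T·M = M}) = 8·Σᶠ_{M₀ ∈ 𝓛₀(T), dualisable} κ⁰_i(M₀)·stabiliserWeight σ M₀`, and ★ LH4-p09
`F0P3cDyRamDiagonalKappaOrbitCountLabelled.cast_sum_signChar_mul_ncard_sep_eq_eight_mul_finsum_kappaCount` is its LABEL-CUT at any vertex type (a predicate `Q` of lattices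
invariant under the diagonal unit torus riding along on both sides, right-hand index `{M ∈ 𝓛₀(T) | Q M}`).  The STAGE-1b square (`sqLevel`) census of the tier-0 regular row
consumes the type-0 instance with the right-hand index CUT TO THE DUALISABLE PART and the label of record `Q M := LatticeInLevel ϖ m (diag e) M` — the binder `hAκ0sq` of
the (S2c) composition engine ★ p859556.  This file is that two-step specialisation and nothing else: §1 cuts ★ LH4-p09's right-hand index to the dualisable part at type 0
(`kappaCount σ ϖ 0 i = 0` off it, ★ `kappaCount_zero_eq_zero_of_not_isDualisableLattice`), §2 instantiates the label (diagonal-invariant by ★ LH4-p09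
`latticeInLevel_mapGL_diagGLUnits_iff`) and ties it into ★ p859556 by elaboration.

* §1 `cast_sum_signChar_mul_ncard_sep_eq_eight_mul_finsum_kappaCount_zero` — labelled (Oκ2c)₀: type 0, any diagonal-invariant label, right-hand index cut to the dualisable part.
* §2 HEAD `cast_sum_signChar_mul_ncard_inLevel_eq_eight_mul_finsum_kappaCount_zero` — the label of record `LatticeInLevel ϖ m (diag e)`: the binder `hAκ0sq` of ★ p859556
  token for token; TIE PROBE `sqKappaSignModelSum2_of_labelledKappaStageBZero` = ★ `sqKappaSignModelSum2_of_labelledKappaStageB Ω lb A HEAD hBκS0sq` (elaborates).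

HONEST LABEL: helper lane (`--supports stmt-HodgeConjecture-24833`); discharges ONE of the two labelled κ-census inputs of the (L-sq) composition engine — the labelled signed
κ-Stage B₀ `hBκS0sq` stays OPEN; tier-0 rows T₊∕T₋∕reg OPEN; HC_CM is proved only modulo the 7 printed citations (2 remaining named inputs: hLiu418 = stmt-HodgeConjecture-24832,
h413 = stmt-HodgeConjecture-24833) until rung 0 closes.

References (NEVER `[KR2]`):
* [Kottwitz1986BaseChangeUnits] R. Kottwitz, *Base change for unit elements of Hecke algebras*, Compositio Math. 60 (1986), §1 pp. 240–241 (orbit counting on the building,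
  stabiliser weights), §3.
* [Rogawski1990] J. D. Rogawski, *Automorphic Representations of Unitary Groups in Three Variables*, Ann. of Math. Stud. 123 (1990), §4.9 Prop. 4.9.1 (a) p. 55 (the
  κ-orbital integral of a regular unit diagonal element as a signed lattice count).
* [LanglandsShelstad1987] R. P. Langlands, D. Shelstad, *On the definition of transfer factors*, Math. Ann. 278 (1987), §3 (the sign character `κ`).
* [Serre1980Trees] J.-P. Serre, *Trees*, Springer (1980), Ch. II §1.1.
-/

set_option autoImplicit false

noncomputable section

namespace Summit.HodgeConjecture.HodgeConjecture.Cruxes.H413.F0P3cDyRamLabelledKappaOrbitCountZero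

open Matrix
open Literature.NumberTheory.Automorphic Literature.NumberTheory.Automorphic.HermitianLattice
open Literature.NumberTheory.Automorphic.UnitaryLatticeTree Literature.NumberTheory.Automorphic.UnitaryThreeFourFrame
open Summit.HodgeConjecture.HodgeConjecture.Cruxes.H413.F0P3cDyRamDiagonalTorusDefs
open Summit.HodgeConjecture.HodgeConjecture.Cruxes.H413.F0P3cDyRamDiagonalStrataDefs
open Summit.HodgeConjecture.HodgeConjecture.Cruxes.H413.F0P3cDyRamDiagonalUnitTorusOrbit
open Summit.HodgeConjecture.HodgeConjecture.Cruxes.H413.F0P3cDyRamDiagonalPairReindex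
open Summit.HodgeConjecture.HodgeConjecture.Cruxes.H413.F0P3cDyRamDiagonalFixedFinite
open Summit.HodgeConjecture.HodgeConjecture.Cruxes.H413.F0P3cDyRamDiagonalStableLatticesFinite
open Summit.HodgeConjecture.HodgeConjecture.Cruxes.H413.F0P3cDyRamDiagonalOrbitAveraging
open Summit.HodgeConjecture.HodgeConjecture.Cruxes.H413.F0P3cDyRamDiagonalOrbitFibreTransport
open Summit.HodgeConjecture.HodgeConjecture.Cruxes.H413.F0P3cDyRamDiagonalOrbitFibreCountHeads
open Summit.HodgeConjecture.HodgeConjecture.Cruxes.H413.F0P3cDyRamDiagonalKappaCountDefs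
open Summit.HodgeConjecture.HodgeConjecture.Cruxes.H413.F0P3cDyRamDiagonalKappaCountEval
open Summit.HodgeConjecture.HodgeConjecture.Cruxes.H413.F0P3cDyRamDiagonalKappaOrbitFibreCount
open Summit.HodgeConjecture.HodgeConjecture.Cruxes.H413.F0P3cDyRamDiagonalKappaOrbitCount
open Summit.HodgeConjecture.HodgeConjecture.Cruxes.H413.F0P3cDyRamFourFrameCensusDefs
open Summit.HodgeConjecture.HodgeConjecture.Cruxes.H413.F0P3cDyRamLevelCountDiagonalModel
open Summit.HodgeConjecture.HodgeConjecture.Cruxes.H413.F0P3cDyRamDiagonalOrbitCountLabelled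
open Summit.HodgeConjecture.HodgeConjecture.Cruxes.H413.F0P3cDyRamDiagonalKappaOrbitCountMult
open Summit.HodgeConjecture.HodgeConjecture.Cruxes.H413.F0P3cDyRamDiagonalKappaOrbitCountLabelled
open Summit.HodgeConjecture.HodgeConjecture.Cruxes.H413.F0P3cDyRamFourFrameLawDefs
open Summit.HodgeConjecture.HodgeConjecture.Cruxes.H413.F0P3cDyRamFourFrameLawDefsR
open Summit.HodgeConjecture.HodgeConjecture.Cruxes.H413.F0P3cDyRamFourFrameLawDefsR2
open scoped Valued WithZero Matrix MatrixGroups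

variable {K : Type} [Field K] [Valued K ℤᵐ⁰]

/-! ## §1  Labelled (Oκ2c)₀: type 0, right-hand index cut to the dualisable part (any diagonal-invariant label) -/

/-- **LABELLED (Oκ2c)₀ — THE LABELLED κ-STAGE A AT TYPE 0, ANY DIAGONAL-INVARIANT LABEL, DUALISABLE CUT.**  For `T = diag(s)` (`s` pairwise-distinct units, finite residue
field), an isometric involution `σ`, a uniformiser `ϖ = ↑ϖu`, a `σ`-fixed NON-NORM unit `c` with the index-two dichotomy, a slot `i` and a label `Q` with `Q(diag(z)·M) ↔ Q(M)`:
`↑(Σ_e χ⁰_i(e) · #{M : M type-0 for diag(c^{e}), T·M = M, Q M}) = 8 · Σᶠ_{M₀ ∈ {M ∈ 𝓛₀(T) | IsDualisableLattice σ ϖ M ∧ Q M}} kappaCount σ ϖ 0 i M₀ · stabiliserWeight σ M₀`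
over `ℚ` — ★ LH4-p09 `cast_sum_signChar_mul_ncard_sep_eq_eight_mul_finsum_kappaCount` at `tv = 0`, then the right-hand finsum restricted to the dualisable part
(`kappaCount σ ϖ 0 i = 0` off it, exactly as in ★ (Oκ2c)₀); `Q ≡ True` is ★ (Oκ2c)₀. [cite: Kottwitz1986BaseChangeUnits, §1 pp. 240–241]
[cite: Rogawski1990, §4.9 Prop. 4.9.1 (a) p. 55] [cite: LanglandsShelstad1987, §3] -/
theorem cast_sum_signChar_mul_ncard_sep_eq_eight_mul_finsum_kappaCount_zero [Finite 𝓀[K]] {σ : K →+* K} (hσ : ∀ x, σ (σ x) = x)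
    (hvσ : ∀ a, Valued.v (σ a) = Valued.v a) {ϖ : K} (hϖ : Valued.v ϖ = WithZero.exp (-1 : ℤ)) (ϖu : Kˣ) (hϖu : (ϖu : K) = ϖ)
    {c : K} (hσc : σ c = c) (hcv : Valued.v c = 1) (hc : ¬ ∃ z : K, z * σ z = c)
    (hdich : ∀ x : K, σ x = x → x ≠ 0 → (∃ z : K, z * σ z = x) ∨ ∃ z : K, z * σ z = c * x)
    {s : Fin 3 → K} (hs : ∀ i, Valued.v (s i) = 1) (hreg : ∀ i j, i ≠ j → s i ≠ s j)
    (T : GL (Fin 3) K) (hT : (T : Matrix (Fin 3) (Fin 3) K) = Matrix.diagonal s) (i : Fin 3)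
    (Q : Submodule 𝒪[K] (Fin 3 → K) → Prop) (hQ : ∀ (z : Fin 3 → Kˣ) (M : Submodule 𝒪[K] (Fin 3 → K)), Q (mapGL (diagGLUnits z) M) ↔ Q M) :
    (((∑ e : Fin 3 → Bool,
        (![(if e 1 then -1 else 1) * (if e 2 then -1 else 1),
           (if e 0 then -1 else 1) * (if e 2 then -1 else 1),
           (if e 0 then -1 else 1) * (if e 1 then -1 else 1)] : Fin 3 → ℤ) i *
          ({M : Submodule 𝒪[K] (Fin 3 → K) |
            IsVertexLattice σ ϖ (Matrix.diagonal fun j => if e j then c else (1 : K)) 0 M ∧ mapGL T M = M ∧ Q M}.ncard : ℤ) : ℤ) : ℚ)) =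
      8 * ∑ᶠ M₀ ∈ {M : Submodule 𝒪[K] (Fin 3 → K) | M ∈ normalisedStableLattices T ∧ IsDualisableLattice σ ϖ M ∧ Q M},
        (kappaCount σ ϖ 0 i M₀ : ℚ) * stabiliserWeight σ M₀ := by
  classical
  rw [cast_sum_signChar_mul_ncard_sep_eq_eight_mul_finsum_kappaCount hσ hvσ hϖ ϖu hϖu hσc hcv hc hdich hs hreg T hT 0 i Q hQ]
  congr 1
  -- restrict to the dualisable part: `kappaCount σ ϖ 0 i = 0` off it
  have h𝓛 : (normalisedStableLattices T).Finite := finite_setOf_normalised_diagonal_fixed_latt hϖ s hs hreg T hT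
  have h𝓛Q : {M : Submodule 𝒪[K] (Fin 3 → K) | M ∈ normalisedStableLattices T ∧ Q M}.Finite := h𝓛.subset fun M hM => hM.1
  have hset : {M : Submodule 𝒪[K] (Fin 3 → K) | M ∈ normalisedStableLattices T ∧ IsDualisableLattice σ ϖ M ∧ Q M} =
      ↑(h𝓛Q.toFinset.filter fun M => IsDualisableLattice σ ϖ M) := by
    ext M
    simp only [Set.mem_setOf_eq, Finset.coe_filter, Set.Finite.mem_toFinset]
    exact ⟨fun h => ⟨⟨h.1, h.2.2⟩, h.2.1⟩, fun h => ⟨h.1.1, h.2, h.1.2⟩⟩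
  rw [hset, finsum_mem_coe_finset, finsum_mem_eq_finite_toFinset_sum _ h𝓛Q, Finset.sum_filter_of_ne]
  intro M _ hne
  by_contra hdual
  apply hne
  rw [kappaCount_zero_eq_zero_of_not_isDualisableLattice σ ϖ i M hdual, Int.cast_zero, zero_mul]

/-! ## §2  HEAD — the label of record `LatticeInLevel ϖ m (diag e)`: the binder `hAκ0sq` of ★ p859556, discharged -/

/-- **(S2a-κ) THE LABELLED κ-STAGE A AT TYPE 0 FOR THE LEVEL LABEL — the first binder `hAκ0sq` of ★
`F0P3cDyRamSqKappaSignModelSumOfLabelledStageB.sqKappaSignModelSum2_of_labelledKappaStageB`, token for token.**  For `T = diag(s)` (`s` pairwise-distinct units, finite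
residue field), an isometric involution `σ`, a uniformiser `ϖ = ↑ϖu`, a `σ`-fixed NON-NORM unit `c` with the index-two dichotomy, a slot `i`, a level `m` and a diagonal
`e : Fin 3 → K`:
`↑(Σ_{e'} χ⁰_i(e') · #{M : M type-0 for diag(c^{e'}), T·M = M, diag(e)·M ⊆ ϖ^m·M}) = 8 · Σᶠ_{M₀ ∈ {M ∈ 𝓛₀(T) | dualisable, diag(e)·M ⊆ ϖ^m·M}} kappaCount σ ϖ 0 i M₀ · stabiliserWeight σ M₀`
over `ℚ` — §1 at the label `LatticeInLevel ϖ m (diag e)`, diagonal-invariant by ★ LH4-p09 `latticeInLevel_mapGL_diagGLUnits_iff`.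
[cite: Kottwitz1986BaseChangeUnits, §1 pp. 240–241] [cite: Rogawski1990, §4.9 Prop. 4.9.1 (a) p. 55] [cite: LanglandsShelstad1987, §3] -/
theorem cast_sum_signChar_mul_ncard_inLevel_eq_eight_mul_finsum_kappaCount_zero [Finite 𝓀[K]] {σ : K →+* K} (hσ : ∀ x, σ (σ x) = x)
    (hvσ : ∀ a, Valued.v (σ a) = Valued.v a) {ϖ : K} (hϖ : Valued.v ϖ = WithZero.exp (-1 : ℤ)) (ϖu : Kˣ) (hϖu : (ϖu : K) = ϖ)
    {c : K} (hσc : σ c = c) (hcv : Valued.v c = 1) (hc : ¬ ∃ z : K, z * σ z = c)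
    (hdich : ∀ x : K, σ x = x → x ≠ 0 → (∃ z : K, z * σ z = x) ∨ ∃ z : K, z * σ z = c * x)
    {s : Fin 3 → K} (hs : ∀ i, Valued.v (s i) = 1) (hreg : ∀ i j, i ≠ j → s i ≠ s j)
    (T : GL (Fin 3) K) (hT : (T : Matrix (Fin 3) (Fin 3) K) = Matrix.diagonal s) (i : Fin 3) (m : ℕ) (e : Fin 3 → K) :
    (((∑ e' : Fin 3 → Bool,
        (![(if e' 1 then -1 else 1) * (if e' 2 then -1 else 1),
           (if e' 0 then -1 else 1) * (if e' 2 then -1 else 1),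
           (if e' 0 then -1 else 1) * (if e' 1 then -1 else 1)] : Fin 3 → ℤ) i *
          ({M : Submodule 𝒪[K] (Fin 3 → K) |
            IsVertexLattice σ ϖ (Matrix.diagonal fun j => if e' j then c else (1 : K)) 0 M ∧ mapGL T M = M ∧
              LatticeInLevel ϖ m (Matrix.diagonal e) M}.ncard : ℤ) : ℤ) : ℚ)) =
      8 * ∑ᶠ M₀ ∈ {M : Submodule 𝒪[K] (Fin 3 → K) | M ∈ normalisedStableLattices T ∧ IsDualisableLattice σ ϖ M ∧ LatticeInLevel ϖ m (Matrix.diagonal e) M},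
        (kappaCount σ ϖ 0 i M₀ : ℚ) * stabiliserWeight σ M₀ :=
  cast_sum_signChar_mul_ncard_sep_eq_eight_mul_finsum_kappaCount_zero hσ hvσ hϖ ϖu hϖu hσc hcv hc hdich hs hreg T hT i
    (fun M => LatticeInLevel ϖ m (Matrix.diagonal e) M) fun z M => latticeInLevel_mapGL_diagGLUnits_iff z ϖ m e M

/-- **TIE PROBE (S2a-κ) ⟶ (S2c)**: the HEAD is the binder `hAκ0sq` of ★ p859556 token for token — fed to the composition engine it leaves EXACTLY the labelled signed κ-Stage B₀
`hBκS0sq` as the one remaining input of the (L-sq) square κ-sign model sum. [cite: Kottwitz1986BaseChangeUnits, §1 pp. 240–241] [cite: Rogawski1990, §4.9 Prop. 4.9.1 (a) p. 55] -/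
theorem sqKappaSignModelSum2_of_labelledKappaStageBZero (Ω : OmegaSchedule) (lb : ℕ → ℕ) (A : ℕ → ℕ → ℕ → ℕ → ℤ → ℚ)
    (hBκS0sq : ∀ {K : Type} [Field K] [Valued K ℤᵐ⁰] [CompleteSpace K] [Fintype 𝓀[K]] {σ : K →+* K} {ϖ : K} {d t : ℕ}, IsRamifiedQuadraticDatum σ ϖ d t →
      Valued.v (2 : K) < 1 → ∀ {δ : K}, σ δ = -δ → δ ≠ 0 →
      ∀ {a b : K}, a * σ a = 1 → b * σ b = 1 → Valued.v (a - 1) < Valued.v (2 : K) → Valued.v (b - 1) < Valued.v (2 : K) →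
      ∀ {n₁ n₂ n₃ : ℕ}, IsElementDatum σ ϖ (depthOfRecord d) (a * a) (b * b) n₁ n₂ n₃ →
      ∀ (T : GL (Fin 3) K), (T : Matrix (Fin 3) (Fin 3) K) = Matrix.diagonal ![a * a, b * b, 1] → ∀ (k : ℕ), 2 * k + d = n₁ + n₂ + n₃ + 2 →
      ∀ (i : Fin 3) (B : ℤ), 2 * B = ((![n₁, n₂, n₃] : Fin 3 → ℕ) i : ℤ) - d + 2 - 2 * shiftR d t →
        ∑ᶠ M ∈ {M : Submodule 𝒪[K] (Fin 3 → K) | M ∈ normalisedStableLattices T ∧ IsDualisableLattice σ ϖ M ∧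
            LatticeInLevel ϖ (lb d) (Matrix.diagonal ![(a * a - 1) * (a * a - 1), (b * b - 1) * (b * b - 1), 0]) M},
            (kappaCount σ ϖ 0 i M : ℚ) * stabiliserWeight σ M =
          ((Ω K σ ϖ d a b i * ((![normSign σ (-1 : K), normSign σ (-1 : K), 1] : Fin 3 → ℤ) i *
            (baseSign σ i * normSign σ (fPartProd δ ![a, b, 1] i))) : ℤ) : ℚ) * A (Fintype.card 𝓀[K]) d t k B / 4)
    {K : Type} [Field K] [Valued K ℤᵐ⁰] [CompleteSpace K] [Fintype 𝓀[K]] (σ : K →+* K) (ϖ : K) (d t : ℕ) :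
    Valued.v (2 : K) < 1 → IsRamifiedQuadraticDatum σ ϖ d t →
      ∀ c : K, σ c = c → Valued.v c = 1 → (∀ x : K, σ x = x → x ≠ 0 → (∃ z : K, z * σ z = x) ∨ ∃ z : K, z * σ z = c * x) →
      ∀ (δ : K), σ δ = -δ → δ ≠ 0 →
      ∀ (a b : K), a * σ a = 1 → b * σ b = 1 → Valued.v (a - 1) < Valued.v (2 : K) → Valued.v (b - 1) < Valued.v (2 : K) →
      ∀ (n₁ n₂ n₃ : ℕ), IsElementDatum σ ϖ (depthOfRecord d) (a * a) (b * b) n₁ n₂ n₃ →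
      ∀ (T : GL (Fin 3) K), (T : Matrix (Fin 3) (Fin 3) K) = Matrix.diagonal ![a * a, b * b, 1] →
      ∀ (k : ℕ), 2 * k + d = n₁ + n₂ + n₃ + 2 →
      ∀ (i : Fin 3) (B : ℤ), 2 * B = ((![n₁, n₂, n₃] : Fin 3 → ℕ) i : ℤ) - d + 2 - 2 * shiftR d t →
        ((∑ s : Fin 3 → Bool,
            (![(if s 1 then -1 else 1) * (if s 2 then -1 else 1),
               (if s 0 then -1 else 1) * (if s 2 then -1 else 1),
               (if s 0 then -1 else 1) * (if s 1 then -1 else 1)] : Fin 3 → ℤ) i *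
              ({M : Submodule 𝒪[K] (Fin 3 → K) |
                IsVertexLattice σ ϖ (Matrix.diagonal fun j => if s j then c else (1 : K)) 0 M ∧ mapGL T M = M ∧
                  LatticeInLevel ϖ (lb d) (Matrix.diagonal ![(a * a - 1) * (a * a - 1), (b * b - 1) * (b * b - 1), 0]) M}.ncard : ℤ) : ℤ) : ℚ) =
          2 * ((Ω K σ ϖ d a b i * ((![normSign σ (-1 : K), normSign σ (-1 : K), 1] : Fin 3 → ℤ) i *
            (baseSign σ i * normSign σ (fPartProd δ ![a, b, 1] i))) : ℤ) : ℚ) * A (Fintype.card 𝓀[K]) d t k B :=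
  F0P3cDyRamSqKappaSignModelSumOfLabelledStageB.sqKappaSignModelSum2_of_labelledKappaStageB Ω lb A
    cast_sum_signChar_mul_ncard_inLevel_eq_eight_mul_finsum_kappaCount_zero hBκS0sq σ ϖ d t

end Summit.HodgeConjecture.HodgeConjecture.Cruxes.H413.F0P3cDyRamLabelledKappaOrbitCountZero

end
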